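import Literature.Geometry.Lorentzian.BondiMass
import Literature.Geometry.Lorentzian.CauchyDevelopment
import HarnessLib

/-!
# Radiated energy through portions of null infinity, and fluxes through null hypersurfaces,
# for Cauchy developments (trunk G08 = T-LORENTZ; definition request
# `defn-CauchyDevelopment.radiatedEnergyBefore` of route FinalStateConjecture/PhotonSphereChannels)

`Literature.Geometry.Lorentzian.BondiMass` renders the Bondi mass *intrinsically* (no conformal
boundary, no news tensor) through the hypothesis structure `BondiFoliation 𝒟` — outgoing null
cones `C⁺_u = ∂J⁺(ι (B u))` of compact pieces of the data, sections `S_{u,s}` receding to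
infinity, `M_B(u) = lim_{s → ∞} m_H(S_{u,s})` (Christodoulou–Klainerman 1993, Ch. 17) — but over
the structure `Development D`, which is **uninhabited** (`Development.elim`, `DevelopmentProofs`;
its Cauchy-surface field uses the misformalised `IsCauchySurface`), so that every statement
quantified over it is vacuous. The repaired carrier is `CauchyDevelopment D`
(`CauchyDevelopment.lean`), over which the final state conjecture and its routes are stated.
This file re-vendors the Bondi foliation and the Bondi mass at the level of a time-oriented
Lorentzian metric `(g, τ)` and a data map `ι : X → M` — so that the *same* structure serves
future null infinity (`τ`) and, by time duality, past null infinity (`τ.reverse`: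
`J⁻_τ = J⁺_{τ.reverse}` by definition, `Causality.lean`) of any `DataEmbedding` /
`CauchyDevelopment` / `VacuumCauchyDevelopment` — and defines on top of it:

* `CauchyDevelopment.radiatedEnergyBefore 𝒟 𝓕 e u₀ : ℝ≥0∞` — the gravitational energy radiated
  through the portion `{u < u₀}` of future null infinity, rendered as the **Bondi-mass drop**
  `E_ADM − M_B(u₀)` along the (future) Bondi foliation `𝓕` of `𝒟`, `E_ADM` the ADM energy of the
  asymptotically flat end `e` of the data (`AFEnd.admEnergy`). By the Bondi mass-loss formula
  this is the news flux `∫_{−∞}^{u₀} ∫_{S²} |Ξ|² dμ du ≥ 0` up to the normalisation of the news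
  (`(8π)⁻¹ ∫∫ |Ξ|²` with Christodoulou–Klainerman's `Ξ = lim r η̂`; `(32π)⁻¹ ∫∫ |Ξ|²` in the
  normalisation quoted in `BondiMass.lean`) for the canonical (optical-function) foliations of the
  cited works (Bondi–van der Burg–Metzner 1962; Christodoulou–Klainerman 1993, Ch. 17,
  Conclusion 17.0.4: `m(t,u) → M(u)`, the Bondi mass formula, and `M(u) →` total mass at the
  spatial-infinity end of `𝓘⁺`; the identification with the news flux is *not* formalised —
  there is no news tensor in the tree — and the printed properties of the canonical foliations are
  the hypothesis structure `LorentzianMetric.BondiFoliation.IsCanonical`, as in `BondiMass.lean`);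
  `CauchyDevelopment.totalRadiatedEnergy` (`= E_ADM − M_B(+∞)` for canonical foliations,
  `totalRadiatedEnergy_eq`);
* `CauchyDevelopment.incomingEnergyAfter 𝒟 𝓕⁻ e v₀ : ℝ≥0∞` — its time reverse: the energy
  entering through the portion `{v > v₀}` of past null infinity, `E_ADM − M_B⁻(v₀)` along a
  *past* Bondi foliation `𝓕⁻` (a Bondi foliation for `τ.reverse`, whose cones are the past cones
  `∂J⁻(ι (B ·))` and whose label is minus the advanced time, `ℓ = −v`);
* `LorentzianMetric.NullSheet g τ` and `NullSheet.fluxBefore 𝓗 T K v₀ : ℝ≥0∞` — a parametrised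
  null hypersurface `(v, y) ↦ S_v(y)` (sections `S_v`, generator `L = ∂_v`, null, future-directed
  and normal to the sections) and the **flux of the energy current `J^K = T(K, ·)`** of a
  symmetric `2`-tensor field `T` along a vector field `K` through its portion `{v < v₀}`,
  `∫_{v < v₀} ∫_{S_v} T(K, L) dA_{S_v} dv` (Dafermos–Rodnianski, arXiv:0811.0354, App. C: on a null
  piece of the boundary one chooses a future-directed null generator `n` and the volume element
  making the divergence theorem hold — for `n = L = ∂_v` this is `dA_{S_v} dv` — and App. D:
  `J^V_μ = T_{μν} V^ν`); with `CauchyDevelopment.futureEventHorizonOf 𝒟 O = ∂J⁻(O) ∩ J⁺(ι X)`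
  and `NullSheet.IsOn` this types "the flux of the `K`-energy current through the part `{v < v₀}`
  of the future event horizon of the outer region `O`, when that boundary is a null hypersurface"
  (the second notion of the request). The integrand `T` is a **parameter**: vacuum general
  relativity has no canonical local energy current of the gravitational field; users take
  `T = stressEnergy ψ` (`EnergyCurrents.lean`) for a scalar field, a Bel–Robinson-type
  superenergy, or a linearised-gravity energy, as their statement requires.

## Main definitions (`namespace Literature.Geometry.Lorentzian`)

* `LorentzianMetric.BondiFoliation g τ ι` — hypothesis structure, the fields of `BondiFoliation`
  (`BondiMass.lean`) verbatim with `𝒟.metric, 𝒟.timeOrientation, 𝒟.embed ↦ g, τ, ι`;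
  `sectionHawkingMass`, `HasBondiMass`, `bondiMass`, `HasFinalBondiMass`, `finalBondiMass`,
  `IsCanonical e D` (one field more than `BondiFoliation.IsCanonical`: `tendsto_bondiMass_atBot`,
  `M_B(u) → E_ADM` as `u → −∞`, CK 1993 Conclusion 17.0.4, which fixes the normalisation
  "no energy has been radiated before the beginning of `𝓘⁺`"), and the proved consequences
  `bondiMass_antitone`, `bondiMass_nonneg`, `bondiMass_le_admEnergy`, `IsCanonical.hasFinalBondiMass`,
  `finalBondiMass_le_admEnergy`, `finalBondiMass_nonneg`.
* `LorentzianMetric.NullSheet g τ`, `NullSheet.generator`, `NullSheet.carrierSet`, `NullSheet.IsOn`,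
  `NullSheet.sectionMeasure`, `NullSheet.fluxBefore`, `NullSheet.totalFlux` (+ `fluxBefore_mono`,
  `fluxBefore_le_totalFlux`).
* `CauchyDevelopment.FutureBondiFoliation 𝒟`, `CauchyDevelopment.PastBondiFoliation 𝒟` (abbrevs),
  `CauchyDevelopment.radiatedEnergyBefore`, `CauchyDevelopment.totalRadiatedEnergy`,
  `CauchyDevelopment.incomingEnergyAfter`, `CauchyDevelopment.futureEventHorizonOf`, with
  `radiatedEnergyBefore_mono` (monotone in `u₀`), `radiatedEnergyBefore_le_admEnergy`,
  `totalRadiatedEnergy_le_admEnergy` (total radiated energy `≤ E_ADM`),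
  `toReal_radiatedEnergyBefore`, `tendsto_radiatedEnergyBefore_atBot`, `totalRadiatedEnergy_eq`,
  `incomingEnergyAfter_antitone`, `incomingEnergyAfter_le_admEnergy`.

## Mathlib

No Lorentzian geometry, Bondi mass or null hypersurfaces in Mathlib (see `BondiMass.lean`). We use
`ENNReal.ofReal`, `Filter.limUnder`, `tendsto_atTop_ciInf`, `tendsto_atTop_iSup`,
`tendsto_nhds_unique`, the lower Lebesgue integral `MeasureTheory.lintegral` and
`Measure.restrict`; everything geometric is from the H21 prelude (`hawkingMass`, `NullNormalPair`,
`futureNullConeBoundary`, `inducedRiemannianMetric`, `riemannianVolume`, `velocity`,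
`IsGeodesicOn`, `TimeOrientation.reverse`, `causalPast`, `AFEnd.admEnergy`, `CauchyDevelopment`).

## Design choices

* *Carrier.* The structure is parametrised by `(g, τ, ι)` rather than by a development, because
  its fields use nothing else; the future/past versions for a Cauchy development `𝒟` are the
  abbreviations `𝒟.FutureBondiFoliation := 𝒟.metric.BondiFoliation 𝒟.timeOrientation 𝒟.embed`
  and `𝒟.PastBondiFoliation := 𝒟.metric.BondiFoliation 𝒟.timeOrientation.reverse 𝒟.embed`
  (dot notation reaches `VacuumCauchyDevelopment` through the parent projections).
* *Labels and signs* (as in `BondiMass.lean`): `u ↦ B u` is antitone and exhausts `X` as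
  `u → −∞`, so `u` increases towards the future along `𝓘⁺`, mass loss reads
  `Antitone bondiMass`, `M_B(−∞) = E_ADM` and `M_B(+∞)` is the final Bondi mass. (Christodoulou–
  Klainerman's optical function increases towards *spatial* infinity — their `u₀` is the value at
  `r = 0` — so their Conclusion 17.0.4 reads "`M(u)` nondecreasing, `M(−∞) = 0`, `M(∞)` the total
  mass"; same statement, opposite orientation of the label.) For a past Bondi foliation the
  structure's label is `ℓ = −v`, `v` the advanced time: in Minkowski space `∂J⁻` of the ball of
  radius `R` in `{t = 0}` is `{t + r = R}`, so larger pieces of the data give *later* advanced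
  times; accordingly `incomingEnergyAfter v₀ = E_ADM − 𝓕⁻.bondiMass (−v₀)`, the past Bondi mass
  `v ↦ 𝓕⁻.bondiMass (−v)` is nondecreasing (incoming radiation), tends to `E_ADM` at spatial
  infinity (`v → +∞`, i.e. `ℓ → −∞`: the field `tendsto_bondiMass_atBot`), and
  `𝓕⁻.finalBondiMass` is the Bondi mass at past timelike infinity.
* *Values in `ℝ≥0∞`* (as requested): `ENNReal.ofReal` of the real Bondi-mass drop; for canonical
  foliations the drop is nonnegative and `toReal` recovers it (`toReal_radiatedEnergyBefore`). The
  ADM energy enters through an explicit end `e : AFEnd X` (`AFEnd.admEnergy e D`, independent of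
  the end structure by Bartnik's theorem, `AFEnd.admEnergy_eq_of_afEnd`).
* *What is not encoded* (exactly as for `BondiFoliation`, see the module docstring of
  `BondiMass.lean`): asymptotic roundness of the sections, the news tensor and the mass-loss
  *formula*; whence the hypothesis structure `IsCanonical` recording what the cited works prove
  for their optical-function foliations. The requirement "agrees with `(32π)⁻¹ ∫∫ |news|²` whenever
  a Penrose compactification exists" is therefore documentation, not a theorem, here.
* *Null sheets.* `NullSheet` records a family of compact spacelike embedded sections
  `S_v = sec v : surf → M` swept injectively, each generator curve `v ↦ sec v y` differentiable
  with velocity `L = ∂_v sec` null, future-directed and `g`-orthogonal to `S_v` (so the swept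
  hypersurface is null where it is immersed); `L` is *not* required to be affinely parametrised
  (on an event horizon `v` is an advanced/Killing time, `∇_L L = κ L`). The flux uses the lower
  Lebesgue integral of `ENNReal.ofReal (T(K, L))`: for `T` obeying the dominant energy condition
  and `K` future causal the integrand is nonnegative (e.g. `stressEnergy_nonneg_of_isTimelike`),
  otherwise negative parts are clipped (documented junk). No measurability is needed to *define* a
  lower integral.

## References

* H. Bondi, M. G. J. van der Burg, A. W. K. Metzner, Proc. Roy. Soc. A 269 (1962) 21–52, §5
  (news, mass loss).
* D. Christodoulou, S. Klainerman, *The global nonlinear stability of the Minkowski space*,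
  Princeton Math. Series 41 (1993), Ch. 17: (17.0.2) Hawking mass, Conclusion 17.0.4 (Bondi mass
  of `C_u` as the limit of Hawking masses, Bondi mass formula, limits at both ends of `𝓘⁺`).
* M. Dafermos, I. Rodnianski, *Lectures on black holes and linear waves*, arXiv:0811.0354,
  §2.6.2 (intrinsic `𝓘⁺`), App. C (divergence theorem with null boundary pieces), App. D (currents
  `J^V_μ = T_{μν} V^ν`).
* S. W. Hawking, J. Math. Phys. 9 (1968) 598 (Hawking mass); J. B. Hartle, S. W. Hawking,
  Comm. Math. Phys. 27 (1972) 283 (energy flux through the horizon).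
* R. Schoen, S.-T. Yau, Phys. Rev. Lett. 48 (1982) 369 (positivity of the Bondi mass).
* R. M. Wald, *General Relativity* (1984), §11.2 (Bondi energy flux), §12.1 (event horizon
  `∂J⁻(𝓘⁺)`); S. W. Hawking, G. F. R. Ellis (1973), §9.2.
-/

noncomputable section

open Bundle Set Manifold TopologicalSpace Filter MeasureTheory Real
open scoped ContDiff Topology ENNReal

namespace Literature.Geometry.Lorentzian

universe u

section MetricLevel

variable {E : Type*} [NormedAddCommGroup E] [NormedSpace ℝ E] {H : Type*} [TopologicalSpace H]
  {I : ModelWithCorners ℝ E H} {M : Type*} [TopologicalSpace M] [ChartedSpace H M]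
  [IsManifold I ∞ M] {X : Type*} [TopologicalSpace X]

namespace LorentzianMetric

/-! ### Time duality for null cone boundaries -/

omit [TopologicalSpace X] in
/-- The future null cone boundary of `B` for the **reversed** time orientation is the **past null
cone boundary** `C⁻(B) = ∂J⁻(ι B)` (by definition of `causalPast` as the causal future of
`τ.reverse`). O'Neill 1983, Ch. 14, p. 403 (time duality). [folklore] -/
lemma futureNullConeBoundary_reverse (g : LorentzianMetric I ∞ M) (τ : TimeOrientation g)
    (ι : X → M) (B : Set X) :
    g.futureNullConeBoundary τ.reverse ι B = frontier (g.causalPast τ (ι '' B)) :=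
  rfl

/-! ### Bondi foliations of a time-oriented Lorentzian manifold relative to a data map -/

section Bondi

variable [FiniteDimensional ℝ E]

/-- Hypothesis structure: a **Bondi foliation** of the time-oriented Lorentzian `4`-manifold
`(M, g, τ)` relative to the data map `ι : X → M` — the intrinsic data from which the Bondi mass is
defined as a limit of Hawking masses along outgoing null cones (Christodoulou–Klainerman 1993,
Ch. 17; Christodoulou, CQG 16 (1999) A23, p. A26). These are **verbatim the fields of
`BondiFoliation`** (`BondiMass.lean`, stated over the uninhabited `Development`), with the
development's metric, time orientation and embedding replaced by the parameters `g`, `τ`, `ι`: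

* a surface type `surf` (compact Hausdorff smooth `2`-manifold with its Borel structure; the seven
  instances are fields), the smoothness fact `hpb` for pullbacks of metrics to `surf`, the standing
  Levi-Civita hypothesis `[hasLeviCivita : g.HasLeviCivita]`;
* an **antitone** family `u ↦ B u` of compact pieces of `X` exhausting `X` as `u → −∞` (`u` a
  retarded time: larger `B` gives an earlier cone `C⁺_u := ∂J⁺(ι (B u))`);
* for each `u` a family `s ↦ sec u s : surf → M` of compact smoothly embedded spacelike sections
  of `C⁺_u` receding to infinity (areas `→ ∞` as `s → ∞`; no leaf/disjointness property);
* null normal pairs `pair u s = (L, L̲)` with `L` tangent to the null geodesic generators of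
  `C⁺_u`.

For `τ.reverse` the cones are the past cones `∂J⁻(ι (B u))` (`futureNullConeBoundary_reverse`)
and the structure is a foliation near **past** null infinity, labelled by minus the advanced
time. Asymptotic roundness and the news tensor are not encoded (see `IsCanonical`).
[cite: ChristodoulouKlainerman1993, Ch. 17, Conclusion 17.0.4] -/
structure BondiFoliation (g : LorentzianMetric I ∞ M) (τ : TimeOrientation g) (ι : X → M) where
  /-- The surface type of the sections. -/
  surf : Type
  /-- Topology of the surface type. -/
  [top : TopologicalSpace surf]
  /-- The surface type is a `2`-manifold. -/
  [charted : ChartedSpace (EuclideanSpace ℝ (Fin 2)) surf]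
  /-- The surface type is a smooth manifold. -/
  [mfd : IsManifold (𝓡 2) ∞ surf]
  /-- The surface type is compact. -/
  [compact : CompactSpace surf]
  /-- The surface type is Hausdorff. -/
  [t2 : T2Space surf]
  /-- Measurable structure of the surface type (for areas and integrals). -/
  [meas : MeasurableSpace surf]
  /-- The measurable structure is the Borel one. -/
  [borel : BorelSpace surf]
  /-- Standing hypothesis: `g` has its Levi-Civita connection. -/
  [hasLeviCivita : g.HasLeviCivita]
  /-- The smoothness fact for pullbacks of metrics along maps `surf → M`. -/
  hpb : PseudoRiemannianMetric.contMDiff_pullbackBilin I M (𝓡 2) surf ∞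
  /-- The compact pieces `B u ⊆ X` of the data, labelled by retarded time `u`. -/
  B : ℝ → Set X
  /-- Each `B u` is compact. -/
  isCompact_B (u : ℝ) : IsCompact (B u)
  /-- Later retarded times correspond to smaller pieces of the data. -/
  antitone_B : Antitone B
  /-- The pieces exhaust the data manifold (as `u → -∞`). -/
  iUnion_B : ⋃ u, B u = univ
  /-- The sections `S_{u,s} = sec u s : surf → M` of the outgoing cones. -/
  sec : ℝ → ℝ → surf → M
  /-- The section `S_{u,s}` lies on the cone `C⁺_u = ∂J⁺(ι (B u))`. -/
  range_sec_subset (u s : ℝ) : range (sec u s) ⊆ g.futureNullConeBoundary τ ι (B u)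
  /-- Each section is a smooth embedding. -/
  isSmoothEmbedding (u s : ℝ) : Manifold.IsSmoothEmbedding (𝓡 2) I ∞ (sec u s)
  /-- Each section is a spacelike immersion. -/
  isSpacelike (u s : ℝ) : g.IsSpacelikeImmersion (𝓡 2) (sec u s)
  /-- The null normal pair `(L, L̲)` of each section, `L` outgoing. -/
  pair (u s : ℝ) : NullNormalPair (𝓡 2) g τ (sec u s)
  /-- `L` is tangent to the null geodesic generators of the cone `C⁺_u`: the geodesic through
  `sec u s y` with velocity `L y` lies in `C⁺_u` for small positive affine parameter. -/
  tangent_L (u s : ℝ) (y : surf) :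
    ∃ (γ : ℝ → M) (ε : ℝ), 0 < ε ∧
      IsGeodesicOn g.leviCivita γ (Ioo (-ε) ε) ∧ γ 0 = sec u s y ∧
      velocity I γ 0 = (pair u s).L y ∧
      ∀ t ∈ Ioo 0 ε, γ t ∈ g.futureNullConeBoundary τ ι (B u)
  /-- The sections recede to infinity along each cone: their areas tend to `∞` as `s → ∞`. -/
  tendsto_area (u : ℝ) :
    Tendsto
      (fun s ↦ totalArea (g.inducedRiemannianMetric (sec u s) hpb (isSpacelike u s)))
      atTop (𝓝 ⊤)

namespace BondiFoliation

attribute [instance] top charted mfd compact t2 meas borel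

variable {g : LorentzianMetric I ∞ M} {τ : TimeOrientation g} {ι : X → M}
  (𝓕 : g.BondiFoliation τ ι)

/-- The Hawking mass `m_H(S_{u,s})` of the section `S_{u,s}` of a Bondi foliation (with respect
to its null normal pair, the bundled smoothness fact `hpb` and Levi-Civita hypothesis).
Christodoulou–Klainerman 1993, Ch. 17, (17.0.2). [cite: ChristodoulouKlainerman1993, Ch. 17, (17.0.2)] -/
def sectionHawkingMass (u s : ℝ) : ℝ :=
  haveI := 𝓕.hasLeviCivita
  g.hawkingMass (𝓕.sec u s) 𝓕.hpb (𝓕.isSpacelike u s) (𝓕.pair u s)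

/-- The Bondi foliation **has Bondi mass `m` at label `u`**: the Hawking masses of the sections
`S_{u,s}` of the cone `C_u` converge to `m` as `s → ∞`. Christodoulou–Klainerman 1993, Ch. 17,
Conclusion 17.0.4 (the Hawking mass tends to the Bondi mass along `C_u`).
[cite: ChristodoulouKlainerman1993, Ch. 17, Conclusion 17.0.4] -/
def HasBondiMass (u m : ℝ) : Prop :=
  Tendsto (𝓕.sectionHawkingMass u) atTop (𝓝 m)

/-- The **Bondi mass** `M_B(u) = lim_{s → ∞} m_H(S_{u,s})` of the Bondi foliation at label `u`: the
limit of the Hawking masses of the sections of the cone `C_u = ∂J^±(ι (B u))` as they recede to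
null infinity (Mathlib's `limUnder`; a **junk value** if the limit does not exist — the honest
predicate is `HasBondiMass`). Bondi–van der Burg–Metzner 1962; Christodoulou–Klainerman 1993,
Ch. 17, Conclusion 17.0.4. [cite: ChristodoulouKlainerman1993, Ch. 17, Conclusion 17.0.4] -/
def bondiMass (u : ℝ) : ℝ :=
  limUnder atTop (𝓕.sectionHawkingMass u)

/-- The Bondi foliation **has final Bondi mass `m`**: `M_B(u) → m` as `u → +∞`.
Christodoulou–Klainerman 1993, Ch. 17, Conclusion 17.0.4 (finite limits of `M` at both ends).
[cite: ChristodoulouKlainerman1993, Ch. 17, Conclusion 17.0.4] -/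
def HasFinalBondiMass (m : ℝ) : Prop :=
  Tendsto 𝓕.bondiMass atTop (𝓝 m)

/-- The **final Bondi mass** `M_B(+∞) = lim_{u → +∞} M_B(u)` (`limUnder`; junk value if the
limit does not exist, see `HasFinalBondiMass`). `E_ADM - M_B(+∞)` is the total energy radiated
through `𝓘⁺`. Christodoulou–Klainerman 1993, Ch. 17, Conclusion 17.0.4; Wald 1984, §11.2.
[cite: ChristodoulouKlainerman1993, Ch. 17, Conclusion 17.0.4] -/
def finalBondiMass : ℝ :=
  limUnder atTop 𝓕.bondiMass

variable {𝓕}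

/-- If the Hawking masses along `C_u` converge to `m`, the Bondi mass at `u` is `m`. [folklore] -/
lemma HasBondiMass.bondiMass_eq {u m : ℝ} (h : 𝓕.HasBondiMass u m) : 𝓕.bondiMass u = m :=
  h.limUnder_eq

/-- If the Bondi masses converge to `m` as `u → +∞`, the final Bondi mass is `m`. [folklore] -/
lemma HasFinalBondiMass.finalBondiMass_eq {m : ℝ} (h : 𝓕.HasFinalBondiMass m) :
    𝓕.finalBondiMass = m :=
  h.limUnder_eq

/-- If the Bondi mass exists at every label, `HasBondiMass u (bondiMass u)`. [folklore] -/
lemma hasBondiMass_bondiMass (h : ∀ u, ∃ m, 𝓕.HasBondiMass u m) (u : ℝ) :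
    𝓕.HasBondiMass u (𝓕.bondiMass u) := by
  obtain ⟨m, hm⟩ := h u
  rwa [hm.bondiMass_eq]

variable (𝓕) [ChartedSpace E3 X] [IsManifold (𝓡 3) ∞ X]

/-- Hypothesis structure: `𝓕` is a **canonical Bondi foliation** for the asymptotically flat end
`e` of the `3`-dimensional initial data set `D` on `X`. It records, as hypotheses, what
Christodoulou–Klainerman 1993, Ch. 17, Conclusion 17.0.4 (for the small-data developments of
their Main Theorem), the Bondi–Sachs analysis (Bondi–van der Burg–Metzner 1962, for spacetimes
admitting their expansion at `𝓘⁺`) and Schoen–Yau, Phys. Rev. Lett. 48 (1982) 369, establish for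
the *optical-function foliation* of a vacuum development of strongly asymptotically flat data
(sections asymptotically round):

* the Hawking masses converge along every cone (`hasBondiMass`; CK, `m(t,u) → M(u)`);
* **Bondi mass loss** `∂_u M_B = -(32π)⁻¹ ∫ |Ξ|² ≤ 0` in the label convention of this file
  (`bondiMass_antitone`; Bondi–van der Burg–Metzner 1962, §5; CK, the Bondi mass formula);
* **positivity of the Bondi mass** (`bondiMass_nonneg`; Schoen–Yau 1982);
* `M_B(u) ≤ E_ADM` (`bondiMass_le_admEnergy`) and — one field more than
  `BondiFoliation.IsCanonical` of `BondiMass.lean` — `M_B(u) → E_ADM` as `u → −∞`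
  (`tendsto_bondiMass_atBot`; CK Conclusion 17.0.4: "`M(u)` converges to the total mass" at the
  spatial-infinity end of `𝓘⁺`, in their orientation of the label `u → ∞`; the total mass of
  strongly asymptotically flat data `h = (1 + 2M/r) δ + …` being its ADM energy), which fixes the
  normalisation of the radiated energy `E_ADM − M_B(u₀)`.

None of this follows from the fields of `BondiFoliation` alone (non-round sections of a
shear-free Schwarzschild cone already give `lim m_H = M √(⨍R²) ⨍(1/R) ≥ M`); the intrinsic
characterisation needs the news tensor, out of scope — whence a hypothesis structure. For a
*past* Bondi foliation (`τ.reverse`) the same fields say: the past Bondi mass is nondecreasing in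
advanced time, nonnegative, `≤ E_ADM`, and tends to `E_ADM` at spatial infinity.
[cite: ChristodoulouKlainerman1993, Ch. 17, Conclusion 17.0.4] [cite: SchoenYau1982] -/
structure IsCanonical (e : AFEnd X) (D : InitialDataSet (𝓡 3) X) : Prop where
  /-- The Hawking masses converge along every cone `C_u` (CK 1993, Conclusion 17.0.4). -/
  hasBondiMass (u : ℝ) : ∃ m, 𝓕.HasBondiMass u m
  /-- Bondi mass loss: `u ↦ M_B(u)` is non-increasing (BvdBM 1962, §5; CK 1993, 17.0.4). -/
  bondiMass_antitone : Antitone 𝓕.bondiMass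
  /-- Positivity of the Bondi mass (Schoen–Yau 1982). -/
  bondiMass_nonneg (u : ℝ) : 0 ≤ 𝓕.bondiMass u
  /-- The Bondi mass is bounded by the ADM energy of the end `e` (CK 1993, 17.0.4). -/
  bondiMass_le_admEnergy (u : ℝ) : 𝓕.bondiMass u ≤ AFEnd.admEnergy e D
  /-- The Bondi mass tends to the ADM energy at the spatial-infinity end of null infinity,
  `u → −∞` (CK 1993, Conclusion 17.0.4, "converges to the total mass"). -/
  tendsto_bondiMass_atBot : Tendsto 𝓕.bondiMass atBot (𝓝 (AFEnd.admEnergy e D))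

variable {𝓕} {e : AFEnd X} {D : InitialDataSet (𝓡 3) X}

/-- For a canonical Bondi foliation, `HasBondiMass u (bondiMass u)` at every label
(Christodoulou–Klainerman 1993, Ch. 17, Conclusion 17.0.4). [cite: ChristodoulouKlainerman1993, Ch. 17, Conclusion 17.0.4] -/
lemma IsCanonical.hasBondiMass_bondiMass (hc : 𝓕.IsCanonical e D) (u : ℝ) :
    𝓕.HasBondiMass u (𝓕.bondiMass u) :=
  BondiFoliation.hasBondiMass_bondiMass hc.hasBondiMass u

/-- **Bondi mass loss** (Bondi–van der Burg–Metzner, Proc. Roy. Soc. A 269 (1962), §5;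
Christodoulou–Klainerman 1993, Ch. 17, Conclusion 17.0.4, the Bondi mass formula): for a canonical
Bondi foliation the Bondi mass is a non-increasing function of the label (a field of
`IsCanonical`, restated). [cite: BondiVanderburgMetzner1962, §5] -/
theorem bondiMass_antitone (hc : 𝓕.IsCanonical e D) : Antitone 𝓕.bondiMass :=
  hc.2

/-- **Positivity of the Bondi mass** (Schoen–Yau, Phys. Rev. Lett. 48 (1982) 369): for a
canonical Bondi foliation the Bondi mass is nonnegative (a field of `IsCanonical`, restated).
[cite: SchoenYau1982] -/
theorem bondiMass_nonneg (hc : 𝓕.IsCanonical e D) (u : ℝ) : 0 ≤ 𝓕.bondiMass u :=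
  hc.3 u

/-- **The Bondi mass is bounded by the ADM energy** (Christodoulou–Klainerman 1993, Ch. 17,
Conclusion 17.0.4 with the mass formula): `M_B(u) ≤ E_ADM`; the difference is the energy radiated
through `𝓘⁺` before `u` (a field of `IsCanonical`, restated). [cite: ChristodoulouKlainerman1993, Ch. 17, Conclusion 17.0.4] -/
theorem bondiMass_le_admEnergy (hc : 𝓕.IsCanonical e D) (u : ℝ) :
    𝓕.bondiMass u ≤ AFEnd.admEnergy e D :=
  hc.4 u

/-- A non-increasing function bounded below converges at `+∞`: for a canonical Bondi foliation
the final Bondi mass exists and equals `⨅ u, M_B(u)`. Christodoulou–Klainerman 1993, Ch. 17,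
Conclusion 17.0.4 (finite limits at both ends). [cite: ChristodoulouKlainerman1993, Ch. 17, Conclusion 17.0.4] -/
theorem IsCanonical.hasFinalBondiMass (hc : 𝓕.IsCanonical e D) :
    𝓕.HasFinalBondiMass (⨅ u, 𝓕.bondiMass u) :=
  tendsto_atTop_ciInf hc.bondiMass_antitone ⟨0, by rintro _ ⟨u, rfl⟩; exact hc.bondiMass_nonneg u⟩

/-- **Final Bondi mass vs ADM mass**: for a canonical Bondi foliation `M_B(+∞) ≤ E_ADM`
(`E_ADM - M_B(+∞)` being the total radiated energy, `CauchyDevelopment.totalRadiatedEnergy_eq`).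
Christodoulou–Klainerman 1993, Ch. 17, Conclusion 17.0.4; Bondi–van der Burg–Metzner 1962.
[cite: ChristodoulouKlainerman1993, Ch. 17, Conclusion 17.0.4] -/
theorem finalBondiMass_le_admEnergy (hc : 𝓕.IsCanonical e D) :
    𝓕.finalBondiMass ≤ AFEnd.admEnergy e D := by
  have hm := hc.hasFinalBondiMass
  rw [hm.finalBondiMass_eq]
  exact le_of_tendsto' hm fun u ↦ bondiMass_le_admEnergy hc u

/-- For a canonical Bondi foliation the final Bondi mass is nonnegative (Schoen–Yau 1982).
[cite: SchoenYau1982] -/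
theorem finalBondiMass_nonneg (hc : 𝓕.IsCanonical e D) : 0 ≤ 𝓕.finalBondiMass := by
  have hm := hc.hasFinalBondiMass
  rw [hm.finalBondiMass_eq]
  exact ge_of_tendsto' hm fun u ↦ bondiMass_nonneg hc u

/-- For a canonical Bondi foliation the final Bondi mass is at most every Bondi mass:
`M_B(+∞) ≤ M_B(u)` (mass loss). Bondi–van der Burg–Metzner 1962, §5. [cite: BondiVanderburgMetzner1962, §5] -/
theorem finalBondiMass_le_bondiMass (hc : 𝓕.IsCanonical e D) (u : ℝ) :
    𝓕.finalBondiMass ≤ 𝓕.bondiMass u := by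
  rw [hc.hasFinalBondiMass.finalBondiMass_eq]
  exact ciInf_le ⟨0, by rintro _ ⟨u', rfl⟩; exact hc.bondiMass_nonneg u'⟩ u

end BondiFoliation

end Bondi

/-! ### Parametrised null hypersurfaces and fluxes of energy currents through them -/

/-- Hypothesis structure: a **parametrised null hypersurface** ("null sheet") of the time-oriented
Lorentzian manifold `(M, g, τ)`, e.g. a portion of a future event horizon parametrised by advanced
time `v` and foliated by its sections `S_v`. It bundles a surface type `surf` (compact Hausdorff
smooth `2`-manifold with its Borel structure, instances as fields), the smoothness fact `hpb` for
pullbacks of metrics to `surf`, and a map `sec : ℝ → surf → M`, `(v, y) ↦ S_v(y)`, such that: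
`(v, y) ↦ sec v y` is injective (the sheet is swept out once); each section `sec v` is a compact
smoothly embedded spacelike surface; each generator curve `v ↦ sec v y` is differentiable, with
velocity `L = ∂_v sec` **null, future-directed and `g`-orthogonal to the section `S_v`** — so
that, where immersed, the swept hypersurface `{sec v y}` is null with generator `L` (Hawking–Ellis
1973, §4.2–§4.3 and §9.2: a null hypersurface is ruled by null geodesic generators orthogonal to
its spacelike sections). The parameter `v` is *not* required to be affine (on a Killing horizon
`v` is a Killing/advanced time). This is the datum needed to integrate a current over the sheet
with the normalisation `n = L = ∂_v`, volume element `dA_{S_v} dv` (Dafermos–Rodnianski,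
arXiv:0811.0354, App. C). [cite: arXiv08110354, App. C] -/
structure NullSheet (g : LorentzianMetric I ∞ M) (τ : TimeOrientation g) where
  /-- The surface type of the sections. -/
  surf : Type
  /-- Topology of the surface type. -/
  [top : TopologicalSpace surf]
  /-- The surface type is a `2`-manifold. -/
  [charted : ChartedSpace (EuclideanSpace ℝ (Fin 2)) surf]
  /-- The surface type is a smooth manifold. -/
  [mfd : IsManifold (𝓡 2) ∞ surf]
  /-- The surface type is compact. -/
  [compact : CompactSpace surf]
  /-- The surface type is Hausdorff. -/
  [t2 : T2Space surf]
  /-- Measurable structure of the surface type (for areas and integrals). -/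
  [meas : MeasurableSpace surf]
  /-- The measurable structure is the Borel one. -/
  [borel : BorelSpace surf]
  /-- The smoothness fact for pullbacks of metrics along maps `surf → M`. -/
  hpb : PseudoRiemannianMetric.contMDiff_pullbackBilin I M (𝓡 2) surf ∞
  /-- The sections `S_v = sec v : surf → M`, `v` the parameter along the generators. -/
  sec : ℝ → surf → M
  /-- The sheet is swept out once: `(v, y) ↦ sec v y` is injective. -/
  injective : Function.Injective (Function.uncurry sec)
  /-- Each section is a smooth embedding. -/
  isSmoothEmbedding (v : ℝ) : Manifold.IsSmoothEmbedding (𝓡 2) I ∞ (sec v)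
  /-- Each section is a spacelike immersion. -/
  isSpacelike (v : ℝ) : g.IsSpacelikeImmersion (𝓡 2) (sec v)
  /-- Each generator curve `v ↦ sec v y` is differentiable. -/
  mdifferentiable (y : surf) : MDifferentiable 𝓘(ℝ, ℝ) I (fun v ↦ sec v y)
  /-- The generator `L = ∂_v sec` is null. -/
  isNull (v : ℝ) (y : surf) : g.IsNull (velocity I (fun v' ↦ sec v' y) v)
  /-- The generator `L` is future-directed. -/
  isFutureDirected (v : ℝ) (y : surf) : τ.IsFutureDirected (velocity I (fun v' ↦ sec v' y) v)
  /-- The generator `L` is `g`-orthogonal to the sections. -/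
  isNormalTo (v : ℝ) : g.IsNormalTo (𝓡 2) (sec v) (fun y ↦ velocity I (fun v' ↦ sec v' y) v)

namespace NullSheet

attribute [instance] top charted mfd compact t2 meas borel

variable {g : LorentzianMetric I ∞ M} {τ : TimeOrientation g} (𝓗 : g.NullSheet τ)

/-- The **generator** `L_v(y) = ∂_v sec v y ∈ T_{S_v(y)} M` of the null sheet (null,
future-directed, orthogonal to `S_v`). Hawking–Ellis 1973, §4.2. [cite: HawkingEllis1973, §4.2] -/
def generator (v : ℝ) (y : 𝓗.surf) : TangentSpace I (𝓗.sec v y) :=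
  velocity I (fun v' ↦ 𝓗.sec v' y) v

/-- The generator is null. [folklore] -/
lemma isNull_generator (v : ℝ) (y : 𝓗.surf) : g.IsNull (𝓗.generator v y) :=
  𝓗.isNull v y

/-- The generator is future-directed. [folklore] -/
lemma isFutureDirected_generator (v : ℝ) (y : 𝓗.surf) : τ.IsFutureDirected (𝓗.generator v y) :=
  𝓗.isFutureDirected v y

/-- The subset of `M` swept out by the null sheet, `⋃_v S_v`. [folklore] -/
def carrierSet : Set M :=
  range (Function.uncurry 𝓗.sec)

/-- Every section lies in the swept set. [folklore] -/
lemma range_sec_subset_carrierSet (v : ℝ) : range (𝓗.sec v) ⊆ 𝓗.carrierSet := by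
  rintro _ ⟨y, rfl⟩
  exact ⟨(v, y), rfl⟩

/-- The null sheet **lies on** the subset `A ⊆ M` (e.g. `A` a future event horizon
`CauchyDevelopment.futureEventHorizonOf`): every section is contained in `A`. [folklore] -/
def IsOn (A : Set M) : Prop :=
  𝓗.carrierSet ⊆ A

/-- Unfolding lemma: the sheet lies on `A` iff all its sections do. [folklore] -/
lemma isOn_iff (A : Set M) : 𝓗.IsOn A ↔ ∀ v, range (𝓗.sec v) ⊆ A := by
  constructor
  · exact fun h v ↦ (𝓗.range_sec_subset_carrierSet v).trans h
  · rintro h _ ⟨⟨v, y⟩, rfl⟩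
    exact h v ⟨y, rfl⟩

/-- `IsOn` is monotone in the set. [folklore] -/
lemma IsOn.mono {A A' : Set M} (h : 𝓗.IsOn A) (hA : A ⊆ A') : 𝓗.IsOn A' :=
  Set.Subset.trans h hA

/-- The **area measure** `dA_{S_v}` of the section `S_v`: the `2`-dimensional Riemannian volume
of the induced metric (`riemannianVolume (sec v^* g) 2`, `Volume.lean`). [folklore] -/
def sectionMeasure (v : ℝ) : Measure 𝓗.surf :=
  riemannianVolume (g.inducedRiemannianMetric (𝓗.sec v) 𝓗.hpb (𝓗.isSpacelike v)) 2

/-- The **flux of the energy current `J^K = T(K, ·)` through the portion `{v < v₀}` of the null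
sheet**: `∫_{v < v₀} ∫_{S_v} T(K, L) dA_{S_v} dv`, where `L = ∂_v` is the generator — the
boundary term of the divergence theorem for a null boundary piece with the choice of null
generator `n = L` and the matching volume element `dA_{S_v} dv` (Dafermos–Rodnianski,
arXiv:0811.0354, App. C; App. D: `J^V_μ = T_{μν} V^ν` for the energy–momentum tensor `T`). Here
`T` is any field of bilinear forms on the tangent spaces (for a scalar field `stressEnergy ψ` of
`EnergyCurrents.lean`; for the gravitational field a user-chosen superenergy or linearised
energy) and `K` any vector field (e.g. the Hawking field of a Kerr horizon). Lower Lebesgue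
integral of `ENNReal.ofReal (T(K, L))`: nonnegative integrand under the dominant energy condition
with `K` future causal; negative parts are clipped otherwise. [cite: arXiv08110354, App. C–D] -/
def fluxBefore (T : Π x : M, LinearMap.BilinForm ℝ (TangentSpace I x))
    (K : Π x : M, TangentSpace I x) (v₀ : ℝ) : ℝ≥0∞ :=
  ∫⁻ v in Iio v₀, ∫⁻ y, ENNReal.ofReal (T (𝓗.sec v y) (K (𝓗.sec v y)) (𝓗.generator v y))
    ∂(𝓗.sectionMeasure v)

/-- The **total flux** of the energy current `J^K = T(K, ·)` through the whole null sheet,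
`∫_ℝ ∫_{S_v} T(K, L) dA_{S_v} dv`. Dafermos–Rodnianski, arXiv:0811.0354, App. C–D.
[cite: arXiv08110354, App. C–D] -/
def totalFlux (T : Π x : M, LinearMap.BilinForm ℝ (TangentSpace I x))
    (K : Π x : M, TangentSpace I x) : ℝ≥0∞ :=
  ∫⁻ v, ∫⁻ y, ENNReal.ofReal (T (𝓗.sec v y) (K (𝓗.sec v y)) (𝓗.generator v y))
    ∂(𝓗.sectionMeasure v)

variable {𝓗} {T : Π x : M, LinearMap.BilinForm ℝ (TangentSpace I x)}
  {K : Π x : M, TangentSpace I x}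

/-- The flux through `{v < v₀}` is monotone in `v₀` (a nonnegative density integrated over a
growing portion). [folklore] -/
theorem fluxBefore_mono : Monotone (𝓗.fluxBefore T K) :=
  fun _ _ h ↦ lintegral_mono_set (Iio_subset_Iio h)

/-- The flux through `{v < v₀}` is at most the total flux. [folklore] -/
theorem fluxBefore_le_totalFlux (v₀ : ℝ) : 𝓗.fluxBefore T K v₀ ≤ 𝓗.totalFlux T K :=
  setLIntegral_le_lintegral _ _

end NullSheet

end LorentzianMetric

end MetricLevel

/-! ### Radiated and incoming energy for Cauchy developments of `3`-dimensional data -/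

namespace CauchyDevelopment

variable {X : Type u} [TopologicalSpace X] [ChartedSpace E3 X] [IsManifold (𝓡 3) ∞ X]
  [ConnectedSpace X] {D : InitialDataSet (𝓡 3) X}

/-- A **(future) Bondi foliation of the Cauchy development `𝒟 = (M, g, τ, ι, ν)`**: a Bondi
foliation of `(g, τ)` relative to `ι` — outgoing cones `∂J⁺(ι (B u))`, sections receding to
future null infinity. Christodoulou–Klainerman 1993, Ch. 17. [cite: ChristodoulouKlainerman1993, Ch. 17, Conclusion 17.0.4] -/
abbrev FutureBondiFoliation (𝒟 : CauchyDevelopment D) :=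
  𝒟.metric.BondiFoliation 𝒟.timeOrientation 𝒟.embed

/-- A **past Bondi foliation of the Cauchy development `𝒟`**: a Bondi foliation of
`(g, τ.reverse)` relative to `ι` — past cones `∂J⁻(ι (B ℓ))`
(`LorentzianMetric.futureNullConeBoundary_reverse`), sections receding to *past* null infinity,
labelled by `ℓ = −v` with `v` the advanced time (module docstring, *Labels and signs*).
Time dual of Christodoulou–Klainerman 1993, Ch. 17. [cite: ChristodoulouKlainerman1993, Ch. 17, Conclusion 17.0.4] -/
abbrev PastBondiFoliation (𝒟 : CauchyDevelopment D) :=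
  𝒟.metric.BondiFoliation 𝒟.timeOrientation.reverse 𝒟.embed

/-- The **energy radiated through the portion `{u < u₀}` of future null infinity** by the Cauchy
development `𝒟` of the `3`-dimensional data `D`, along its (future) Bondi foliation `𝓕` and for
the asymptotically flat end `e` of the data: the Bondi-mass drop `E_ADM − M_B(u₀)` as an extended
nonnegative real (`ENNReal.ofReal`; `E_ADM = AFEnd.admEnergy e D`, `M_B = 𝓕.bondiMass`). For the
canonical foliations (`𝓕.IsCanonical e D`) this equals the news flux through `{u < u₀}`,
`(8π)⁻¹ ∫_{−∞}^{u₀} ∫_{S²} |Ξ|² dμ du` in Christodoulou–Klainerman's normalisation of `Ξ`, by the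
Bondi mass-loss formula (not formalised: no news tensor), is monotone in `u₀`
(`radiatedEnergyBefore_mono`), bounded by `E_ADM` (`radiatedEnergyBefore_le_admEnergy`) and tends
to `0` as `u₀ → −∞` (`tendsto_radiatedEnergyBefore_atBot`). Bondi–van der Burg–Metzner 1962, §5;
Christodoulou–Klainerman 1993, Ch. 17, Conclusion 17.0.4; Wald 1984, §11.2.
[cite: ChristodoulouKlainerman1993, Ch. 17, Conclusion 17.0.4] [cite: BondiVanderburgMetzner1962, §5] -/
def radiatedEnergyBefore (𝒟 : CauchyDevelopment D) (𝓕 : 𝒟.FutureBondiFoliation) (e : AFEnd X)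
    (u₀ : ℝ) : ℝ≥0∞ :=
  ENNReal.ofReal (AFEnd.admEnergy e D - 𝓕.bondiMass u₀)

/-- The **total energy radiated through future null infinity**, `⨆_{u₀} radiatedEnergyBefore u₀`
(`= E_ADM − M_B(+∞)` for canonical foliations, `totalRadiatedEnergy_eq`). Christodoulou–Klainerman
1993, Ch. 17, Conclusion 17.0.4; Wald 1984, §11.2. [cite: ChristodoulouKlainerman1993, Ch. 17, Conclusion 17.0.4] -/
def totalRadiatedEnergy (𝒟 : CauchyDevelopment D) (𝓕 : 𝒟.FutureBondiFoliation) (e : AFEnd X) :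
    ℝ≥0∞ :=
  ⨆ u₀, 𝒟.radiatedEnergyBefore 𝓕 e u₀

/-- The **energy entering through the portion `{v > v₀}` of past null infinity** (time reverse of
`radiatedEnergyBefore`): `E_ADM − M_B⁻(v₀)` along the past Bondi foliation `𝓕⁻` of `𝒟`, whose
label is `ℓ = −v` (so `M_B⁻(v₀) = 𝓕⁻.bondiMass (−v₀)`), as an extended nonnegative real. For
canonical past foliations it is antitone in `v₀` (`incomingEnergyAfter_antitone`) and bounded by
`E_ADM`. Time dual of Bondi–van der Burg–Metzner 1962, §5 and Christodoulou–Klainerman 1993,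
Ch. 17, Conclusion 17.0.4. [cite: ChristodoulouKlainerman1993, Ch. 17, Conclusion 17.0.4] -/
def incomingEnergyAfter (𝒟 : CauchyDevelopment D) (𝓕 : 𝒟.PastBondiFoliation) (e : AFEnd X)
    (v₀ : ℝ) : ℝ≥0∞ :=
  ENNReal.ofReal (AFEnd.admEnergy e D - 𝓕.bondiMass (-v₀))

/-- The **future event horizon of the region `O`** of the Cauchy development `𝒟`:
`𝓗⁺(O) := ∂J⁻(O) ∩ J⁺(ι X)`, the frontier of the causal past of `O` to the causal future of the
data hypersurface. For `O = J⁻(𝓘⁺) ∩ M` (or an `𝓘⁺`-free stand-in such as the chronological past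
of future-complete null rays from the data) this is the event horizon `∂J⁻(𝓘⁺)` after the
initial slice (Wald 1984, §12.1; Hawking–Ellis 1973, §9.2). A `NullSheet` `𝓗` with
`𝓗.IsOn (𝒟.futureEventHorizonOf O)` parametrises (part of) it when it is a null hypersurface, and
`𝓗.fluxBefore T K v₀` is then the horizon flux of the `K`-current before advanced time `v₀`.
[cite: Wald1984, §12.1] -/
def futureEventHorizonOf (𝒟 : CauchyDevelopment D) (O : Set 𝒟.carrier) : Set 𝒟.carrier :=
  frontier (𝒟.metric.causalPast 𝒟.timeOrientation O) ∩
    𝒟.metric.causalFuture 𝒟.timeOrientation (range 𝒟.embed)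

/-- The future event horizon of `O` lies to the causal future of the data hypersurface.
[folklore] -/
theorem futureEventHorizonOf_subset_causalFuture (𝒟 : CauchyDevelopment D) (O : Set 𝒟.carrier) :
    𝒟.futureEventHorizonOf O ⊆ 𝒟.metric.causalFuture 𝒟.timeOrientation (range 𝒟.embed) :=
  inter_subset_right

/-- The future event horizon of `O` lies in the frontier of `J⁻(O)`. [folklore] -/
theorem futureEventHorizonOf_subset_frontier (𝒟 : CauchyDevelopment D) (O : Set 𝒟.carrier) :
    𝒟.futureEventHorizonOf O ⊆ frontier (𝒟.metric.causalPast 𝒟.timeOrientation O) :=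
  inter_subset_left

variable {𝒟 : CauchyDevelopment D} {e : AFEnd X}

section Future

variable {𝓕 : 𝒟.FutureBondiFoliation}

/-- Unfolding lemma for `radiatedEnergyBefore`. [folklore] -/
theorem radiatedEnergyBefore_eq (u₀ : ℝ) :
    𝒟.radiatedEnergyBefore 𝓕 e u₀ = ENNReal.ofReal (AFEnd.admEnergy e D - 𝓕.bondiMass u₀) :=
  rfl

/-- **The radiated energy is monotone in the retarded time** (Bondi mass loss): for a canonical
Bondi foliation `u₀ ↦ E_ADM − M_B(u₀)` is non-decreasing. Bondi–van der Burg–Metzner 1962, §5;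
Christodoulou–Klainerman 1993, Ch. 17, Conclusion 17.0.4. [cite: BondiVanderburgMetzner1962, §5] -/
theorem radiatedEnergyBefore_mono (hc : 𝓕.IsCanonical e D) :
    Monotone (𝒟.radiatedEnergyBefore 𝓕 e) :=
  fun _ _ h ↦ ENNReal.ofReal_le_ofReal (sub_le_sub_left (hc.bondiMass_antitone h) _)

/-- **The radiated energy is bounded by the ADM energy** (positivity of the Bondi mass,
Schoen–Yau 1982): `E_ADM − M_B(u₀) ≤ E_ADM`. [cite: SchoenYau1982] -/
theorem radiatedEnergyBefore_le_admEnergy (hc : 𝓕.IsCanonical e D) (u₀ : ℝ) :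
    𝒟.radiatedEnergyBefore 𝓕 e u₀ ≤ ENNReal.ofReal (AFEnd.admEnergy e D) :=
  ENNReal.ofReal_le_ofReal (sub_le_self _ (hc.bondiMass_nonneg u₀))

/-- The radiated energy is finite. [folklore] -/
theorem radiatedEnergyBefore_lt_top (u₀ : ℝ) : 𝒟.radiatedEnergyBefore 𝓕 e u₀ < ⊤ :=
  ENNReal.ofReal_lt_top

/-- For a canonical Bondi foliation the real value of the radiated energy is the Bondi-mass drop
`E_ADM − M_B(u₀)` (nonnegative since `M_B ≤ E_ADM`). Christodoulou–Klainerman 1993, Ch. 17,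
Conclusion 17.0.4. [cite: ChristodoulouKlainerman1993, Ch. 17, Conclusion 17.0.4] -/
theorem toReal_radiatedEnergyBefore (hc : 𝓕.IsCanonical e D) (u₀ : ℝ) :
    (𝒟.radiatedEnergyBefore 𝓕 e u₀).toReal = AFEnd.admEnergy e D - 𝓕.bondiMass u₀ :=
  ENNReal.toReal_ofReal (sub_nonneg.mpr (hc.bondiMass_le_admEnergy u₀))

/-- **No energy is radiated before the beginning of null infinity**: for a canonical Bondi
foliation `radiatedEnergyBefore u₀ → 0` as `u₀ → −∞` (since `M_B(u) → E_ADM`,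
Christodoulou–Klainerman 1993, Ch. 17, Conclusion 17.0.4). [cite: ChristodoulouKlainerman1993, Ch. 17, Conclusion 17.0.4] -/
theorem tendsto_radiatedEnergyBefore_atBot (hc : 𝓕.IsCanonical e D) :
    Tendsto (𝒟.radiatedEnergyBefore 𝓕 e) atBot (𝓝 0) := by
  have h : Tendsto (fun u ↦ AFEnd.admEnergy e D - 𝓕.bondiMass u) atBot
      (𝓝 (AFEnd.admEnergy e D - AFEnd.admEnergy e D)) :=
    tendsto_const_nhds.sub hc.tendsto_bondiMass_atBot
  rw [sub_self] at h
  have h' := (ENNReal.continuous_ofReal.tendsto 0).comp h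
  rwa [ENNReal.ofReal_zero] at h'

/-- **The total radiated energy is bounded by the ADM energy** (Bondi mass loss and positivity
of the Bondi mass). Christodoulou–Klainerman 1993, Ch. 17, Conclusion 17.0.4; Schoen–Yau 1982.
[cite: SchoenYau1982] -/
theorem totalRadiatedEnergy_le_admEnergy (hc : 𝓕.IsCanonical e D) :
    𝒟.totalRadiatedEnergy 𝓕 e ≤ ENNReal.ofReal (AFEnd.admEnergy e D) :=
  iSup_le fun u₀ ↦ radiatedEnergyBefore_le_admEnergy hc u₀

/-- Every partial radiated energy is at most the total one. [folklore] -/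
theorem radiatedEnergyBefore_le_totalRadiatedEnergy (u₀ : ℝ) :
    𝒟.radiatedEnergyBefore 𝓕 e u₀ ≤ 𝒟.totalRadiatedEnergy 𝓕 e :=
  le_iSup (𝒟.radiatedEnergyBefore 𝓕 e) u₀

/-- **Total radiated energy = ADM energy − final Bondi mass** for a canonical Bondi foliation:
`⨆_{u₀} (E_ADM − M_B(u₀)) = E_ADM − M_B(+∞)` (the Bondi masses decrease to their infimum, the
final Bondi mass, and `ENNReal.ofReal` is continuous and monotone). Christodoulou–Klainerman 1993,
Ch. 17, Conclusion 17.0.4; Wald 1984, §11.2. [cite: ChristodoulouKlainerman1993, Ch. 17, Conclusion 17.0.4] -/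
theorem totalRadiatedEnergy_eq (hc : 𝓕.IsCanonical e D) :
    𝒟.totalRadiatedEnergy 𝓕 e = ENNReal.ofReal (AFEnd.admEnergy e D - 𝓕.finalBondiMass) := by
  have h1 : Tendsto (𝒟.radiatedEnergyBefore 𝓕 e) atTop (𝓝 (𝒟.totalRadiatedEnergy 𝓕 e)) :=
    tendsto_atTop_iSup (radiatedEnergyBefore_mono hc)
  have hfin := hc.hasFinalBondiMass
  have h2 : Tendsto (𝒟.radiatedEnergyBefore 𝓕 e) atTop
      (𝓝 (ENNReal.ofReal (AFEnd.admEnergy e D - ⨅ u, 𝓕.bondiMass u))) :=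
    (ENNReal.continuous_ofReal.tendsto _).comp (tendsto_const_nhds.sub hfin)
  rw [hfin.finalBondiMass_eq]
  exact tendsto_nhds_unique h1 h2

end Future

section Past

variable {𝓕 : 𝒟.PastBondiFoliation}

/-- Unfolding lemma for `incomingEnergyAfter`. [folklore] -/
theorem incomingEnergyAfter_eq (v₀ : ℝ) :
    𝒟.incomingEnergyAfter 𝓕 e v₀ = ENNReal.ofReal (AFEnd.admEnergy e D - 𝓕.bondiMass (-v₀)) :=
  rfl

/-- **The incoming energy is antitone in the advanced time**: for a canonical past Bondi
foliation the past Bondi mass `v ↦ M_B⁻(v) = 𝓕⁻.bondiMass (−v)` is nondecreasing, so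
`v₀ ↦ E_ADM − M_B⁻(v₀)` is non-increasing (less radiation enters through a smaller portion
`{v > v₀}`). Time dual of Bondi–van der Burg–Metzner 1962, §5. [cite: BondiVanderburgMetzner1962, §5] -/
theorem incomingEnergyAfter_antitone (hc : 𝓕.IsCanonical e D) :
    Antitone (𝒟.incomingEnergyAfter 𝓕 e) :=
  fun _ _ h ↦ ENNReal.ofReal_le_ofReal
    (sub_le_sub_left (hc.bondiMass_antitone (neg_le_neg h)) _)

/-- The incoming energy is bounded by the ADM energy (positivity of the past Bondi mass).
Time dual of Schoen–Yau 1982. [cite: SchoenYau1982] -/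
theorem incomingEnergyAfter_le_admEnergy (hc : 𝓕.IsCanonical e D) (v₀ : ℝ) :
    𝒟.incomingEnergyAfter 𝓕 e v₀ ≤ ENNReal.ofReal (AFEnd.admEnergy e D) :=
  ENNReal.ofReal_le_ofReal (sub_le_self _ (hc.bondiMass_nonneg (-v₀)))

/-- For a canonical past Bondi foliation the real value of the incoming energy is
`E_ADM − M_B⁻(v₀)`. Time dual of Christodoulou–Klainerman 1993, Ch. 17, Conclusion 17.0.4.
[cite: ChristodoulouKlainerman1993, Ch. 17, Conclusion 17.0.4] -/
theorem toReal_incomingEnergyAfter (hc : 𝓕.IsCanonical e D) (v₀ : ℝ) :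
    (𝒟.incomingEnergyAfter 𝓕 e v₀).toReal = AFEnd.admEnergy e D - 𝓕.bondiMass (-v₀) :=
  ENNReal.toReal_ofReal (sub_nonneg.mpr (hc.bondiMass_le_admEnergy (-v₀)))

/-- **No energy enters after the spatial-infinity end of past null infinity**: for a canonical
past Bondi foliation `incomingEnergyAfter v₀ → 0` as `v₀ → +∞` (`M_B⁻(v) → E_ADM`). Time dual of
Christodoulou–Klainerman 1993, Ch. 17, Conclusion 17.0.4. [cite: ChristodoulouKlainerman1993, Ch. 17, Conclusion 17.0.4] -/
theorem tendsto_incomingEnergyAfter_atTop (hc : 𝓕.IsCanonical e D) :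
    Tendsto (𝒟.incomingEnergyAfter 𝓕 e) atTop (𝓝 0) := by
  have h : Tendsto (fun v ↦ AFEnd.admEnergy e D - 𝓕.bondiMass (-v)) atTop
      (𝓝 (AFEnd.admEnergy e D - AFEnd.admEnergy e D)) :=
    tendsto_const_nhds.sub (hc.tendsto_bondiMass_atBot.comp tendsto_neg_atTop_atBot)
  rw [sub_self] at h
  have h' := (ENNReal.continuous_ofReal.tendsto 0).comp h
  rwa [ENNReal.ofReal_zero] at h'

end Past

end CauchyDevelopment

end Literature.Geometry.Lorentzian

end
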